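import Summits.QuantumFields.BalabanUV.Beta.FP.TowerNWardOfLetters
import Summits.QuantumFields.BalabanUV.Beta.FP.TowerRootCentredComposed
import Summits.QuantumFields.BalabanUV.Beta.CompositeMixedWardClass
import Summits.QuantumFields.BalabanUV.Beta.WilsonBiStencilWardSocketPins
import Summits.QuantumFields.BalabanUV.Beta.CompositeVertexKernelBoundsTwoSym
import Summits.QuantumFields.BalabanUV.Beta.CompositeMixedTableGradedCov
import Summits.QuantumFields.BalabanUV.Beta.SecondOrderTableLawEnd

/-!
# `BalabanUV.Beta.FP.TowerNWardRootedOfPins` — row D1 ∕ (C1) OWNER «beta-an2», PART 116, ROUTE T (β1): **PART 115 INSTANTIATED AT THE ROOTED GRADED COMPOSITE TABLES OF THE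
# CENTRED TOWER, FROM SIX PIN ROWS** — for odd `Lc`, `SU(N_c)` with `2 ≤ N_c`, every depth `j+1`, multiplier scalars `cM` and pins `cE cVH cΛ cE₂ cB T` on the hyperplane
# {`2·cVH = −(Lc⁴)^(j+1)·cE`, `cE² = cE₂`, `2·cB = cE·cVH`, `T = (8N_c²)⁻¹ • wsym22 N_c`, `cM 0 = cΛ`, `cΛ·cE = 2`}: the `hW𝒯 j`-shaped Ward transversality of the composite chart `AN (Roots.ctr Lc) j`
# against the member-0 stencil ∕ W-family of the ROOTED tables (`compVhS`, `compHessFF`, `atw ∘ compVh2S`, graded `compMixFFG` at the corrector's root list) — NO displayed law left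

HONEST DEPENDENCY (page 1, mandatory): continuum YM on T⁴ ⇐ BetaPertH ∧ nine spine estimates (0/9 proved); BetaPertH ⇐ (D1) ∧ (D4) ∧ CAP+tail;
G-an2-4 gates asym, D1 and NE2/3/4.  HONEST FRAMING (cell contract, verbatim): «discharging `BetaPertH` makes Bałaban's UV stability UNCONDITIONAL —
a real constructive-QFT result; it is NOT the continuum limit and NOT the Clay problem.»  ABSOLUTE RULE (cell charter, verbatim): «No internally-minted
statement may enter as a cited fact. Every hypothesis is either kernel-proved in this package or a verbatim quotation of a PUBLISHED theorem with page
reference. The manuscript(s) under audit are NOT citable for their own disputed steps — they are the thing under adjudication; programme-internal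
(2001/route/tribunal) claims are never citable.»

WHY (an2 gen 87; memo `gen87/HWD-INVENTORY-87.md` §1∕§4; PREDICTION-AN2-87a).  PART 115 `wardTransversal_AN_of_letters` displays, for generic tables, the (S)-law, its transported
form and the three (W) letters.  For the ROOTED tables every one of them is a tree theorem: (S) PART 105b∕109 `hSd_S0NOf_compVhS_ctr`, `hD` PART 108∕109 `divV_dM_AN_compVhS_ctr`, Wilson
PART 114 `hWil_wsym22_TW_su` (remainder 0, lock `cE₂ = cE²`), border PART 106c∕109 `hBord_compB_ctr` (remainder 0, lock `cH·cB = ξ·cVH`), mixed PART 110g∕111 (remainder by definition,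
class `vertexFamily_mixedLetterRemainder_rooted`, parity `parityOdd_mixedLetterRemainder_rooted` under `cH = ξ·cM 0`), the table letters F3∕F5∕F6∕(F0) (`locStencil_compVhS_rooted`,
`compHessFF_rooted_hH`, `locStencil₂_compVh2S_rootedSym` + `biLoc_atw`, `compMixFFG_hmix`, the `_translate` letters + `atw_shiftK`; road g64's XREAD-R d8e68c8c assembled exactly
these for its `tabsCompGR` — credited, re-derived here over tree objects only), (V-p)(H-p) `CompositeTablesParity`.  THIS FILE performs the instantiation ONCE, WITHOUT any record:
**`wardTransversal_AN_rooted_of_pins`**.  What stays displayed are SIX SCALAR PIN ROWS and `2 ≤ N_c` — the END skeleton's `hcVH`, `hcE₂`, `hTW`, its `hcB`∕`hr` consequence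
`2·cB = cE·cVH`, and the two W-side rows of PREDICTION-AN2-87a (`cM 0 = cΛ`, `cΛ·cE = 2`).  A rooted record `JNatᴿ` over `tabsCompGR … cM` has `S`∕`W` equal to this file's two families
by `rfl` (`SchartOf_eq`, `WchartOf_eq`); that identification is the referee-gated (O3) port and is NOT made here.

WHAT: [folklore] composition BY NAME; no `def`, no `def … : Prop`, nothing cited, 0 sorry.  Nothing of Bałaban's asserted, valued or discharged; 0 estimates; 0∕4 row-D1 binders;
`hW𝒯 (j ≥ 1)` NOT claimed at the record of record (its sym tables carry the located seam, FINDING AN2-86-1); NOT (C1), NOT (T-ID), NOT D1, NEVER «G-an2-4 closed», NOT BetaPertH,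
NOT continuum, NOT Clay.  Row D1 ∕ (C1) OWNER «beta-an2», gen 87, 2026-08-30.  No existing file touched.
-/

noncomputable section

open Finset
open scoped BigOperators
open Literature.MathematicalPhysics.QuantumFieldTheory
open Literature.MathematicalPhysics.QuantumFieldTheory.Balaban1983to89
open Literature.MathematicalPhysics.QuantumFieldTheory.Balaban1983to89.Beta
open ExpKernelCalculus (MKer Decays BiLoc comp hessKer VertexFamily shiftK)
open PolarizationSign (WardTransversal)
open KernelWard (divV bdd_of_biLoc)
open AffineAveraging (Site box toSite)
open AveragingHessianKernels (ell)
open AveragingHessianKernelsRooted (linKerAt vhKerAt hessKerAt)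
open AveragingMixedJetTables (mixKerAt vh2Abs mixAbs vh2Abs_nonneg mixAbs_nonneg)
open OneStepResolventKernel (Fib LocStencil)
open OneStepKernelFamily (vertexOfK flipK)
open BalabanCompositeJets (LocStencil₂)
open SecondOrderResponse (dM LocStencilFM)
open BalabanStepW2 (M2Of)
open WilsonVertex2Sym (wsym22)
open HessKerRate (biLoc_zero)
open Summit.QuantumFields.BalabanUV.Beta.TameKernelCalculus (trK)
open Summit.QuantumFields.BalabanUV.Beta.BorderedHessian (diagK sgnK)
open Summit.QuantumFields.BalabanUV.Beta.AxialDressingRooted (one_le_of_neZero)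
open Summit.QuantumFields.BalabanUV.Beta.AveragingWardRootedStencils (legInd)
open Summit.QuantumFields.BalabanUV.Beta.SecondOrderSocketIdentification (atw)
open Summit.QuantumFields.BalabanUV.Beta.SecondOrderTableLawEnd (biLoc_atw atw_shiftK)
open Summit.QuantumFields.BalabanUV.Beta.SpineRooted (SpureRecOf WrecOf)
open Summit.QuantumFields.BalabanUV.Beta.WardLocusRecursive (SrecOf)
open Summit.QuantumFields.BalabanUV.Beta.SpineRecursiveParity (parityOdd_zero)
open Summit.QuantumFields.BalabanUV.Beta.SymAveragingHessianCounts (biLoc_smul_ff)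
open StepJetData (biLoc_weaken)
open Summit.QuantumFields.BalabanUV.Beta.CompositeVertexKernelRec (compVhS compVh2S locStencil_compVhS_rooted compVhS_rooted_translate)
open Summit.QuantumFields.BalabanUV.Beta.CompositeVertexKernelBoundsTwoSym (vh2KerSymAt locStencil₂_compVh2S_rootedSym compVh2S_rootedSym_translate)
open Summit.QuantumFields.BalabanUV.Beta.CompositeHessianTable (compHessFF compHessFF_rooted_hH compHessFF_rooted_translate)
open Summit.QuantumFields.BalabanUV.Beta.CompositeTablesParity (trK_compVhS_rooted trK_compHessFF_rooted)
open Summit.QuantumFields.BalabanUV.Beta.CompositeMixedTableGraded (compMixFFG)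
open Summit.QuantumFields.BalabanUV.Beta.CompositeMixedTableGradedCov (compMixFFG_translate)
open Summit.QuantumFields.BalabanUV.Beta.CompositeMixedTableGradedBounds (compMixFFG_hmix)
open Summit.QuantumFields.BalabanUV.Beta.CompositeMixedWardClass (M2Of_member_zero vertexFamily_mixedLetterRemainder_rooted parityOdd_mixedLetterRemainder_rooted)
open Summit.QuantumFields.BalabanUV.Beta.WilsonBiStencilWardSocketPins (hWil_wsym22_TW_su hWil''_wsym22_TW_su)
open Summit.QuantumFields.BalabanUV.Beta.CompositeOneShotJetData (Roots AN)
open Summit.QuantumFields.BalabanUV.Beta.NVertexSectors (decays_AN)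
open Summit.QuantumFields.BalabanUV.Beta.FP.TowerRootCentredComposed (hSd_S0NOf_compVhS_ctr hBord_compB_ctr hBord''_compB_ctr divV_dM_AN_compVhS_ctr)
open Summit.QuantumFields.BalabanUV.Beta.FP.TowerNWardOfLetters (wardTransversal_AN_of_letters)

namespace Summit.QuantumFields.BalabanUV.Beta.FP.TowerNWardRootedOfPins

variable (Lc : ℕ) [NeZero Lc]

/-- [folklore] **`wardTransversal_AN_rooted_of_pins` — THE `hW𝒯 j`-SHAPED WARD TRANSVERSALITY OF THE CENTRED TOWER's COMPOSITE CHART AGAINST THE ROOTED GRADED COMPOSITE TABLES,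
FROM SIX PIN ROWS.**  Objects (all in the tree): root list `rc := (Roots.ctr Lc).rc`, big root `(Roots.ctr Lc).s (j+1)`, `N = Lc^(j+1)`; tables `Vᴿ := compVhS (linKerAt∘rc) (vhKerAt∘rc) Lc (j+1)`,
`Hᴿ := compHessFF (linKerAt∘rc) (hessKerAt∘rc) Lc (j+1)`, `M := fun j′ μ w ↦ cM j′ • Hᴿ μ w`, `Bᴿ := atw ∘ compVh2S … (vh2KerSymAt∘rc)`, `Mixᴿ := compMixFFG … (mixKerAt∘rc)` (graded).
Hypotheses: `Odd Lc`, `2 ≤ N_c`, and the pin rows `hcVH : 2·cVH = −(Lc⁴)^(j+1)·cE`, `hcE₂ : cE² = cE₂`, `hcB : 2·cB = cE·cVH`, `hTW : T = (8N_c²)⁻¹ • wsym22 N_c`, `hcM0 : cM 0 = cΛ`, `hΛE : cΛ·cE = 2`.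
Conclusion: `WardTransversal (flipK (hessKer (AN (Roots.ctr Lc) j) (vertexOfK (AN …) N (SrecOf 3 N Vᴿ Hᴿ _ cE cVH cΛ 0)) (WrecOf 3 N (fun _ ↦ AN …) (SpureRecOf 3 N Vᴿ Hᴿ _ cE cVH cΛ) M cE₂ cB T Bᴿ Mixᴿ 0)))`. -/
theorem wardTransversal_AN_rooted_of_pins (hLc : Odd Lc) {Nc : ℕ} (hNc : 2 ≤ Nc) (j : ℕ) (cM : ℕ → ℝ) (cE cVH cΛ cE₂ cB : ℝ)
    {T : Fin 4 → Fin 4 → Fin 4 → Fin 4 → ℝ}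
    (hcVH : 2 * cVH = -(((Lc : ℝ) ^ (3 + 1)) ^ (j + 1) * cE)) (hcE₂ : cE ^ 2 = cE₂) (hcB : 2 * cB = cE * cVH)
    (hTW : T = (8 * (Nc : ℝ) ^ 2)⁻¹ • wsym22 Nc) (hcM0 : cM 0 = cΛ) (hΛE : cΛ * cE = 2) :
    WardTransversal (flipK (hessKer (AN (Roots.ctr Lc) j)
      (vertexOfK (AN (Roots.ctr Lc) j) (Lc ^ (j + 1))
        (SrecOf 3 (Lc ^ (j + 1))
          (compVhS (fun k => linKerAt (toSite ((Roots.ctr Lc).rc k)) Lc) (fun k => vhKerAt (toSite ((Roots.ctr Lc).rc k)) Lc) Lc (j + 1))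
          (compHessFF (fun k => linKerAt (toSite ((Roots.ctr Lc).rc k)) Lc) (fun k => hessKerAt (toSite ((Roots.ctr Lc).rc k)) Lc) Lc (j + 1))
          (fun _ => AN (Roots.ctr Lc) j) cE cVH cΛ 0))
      (WrecOf 3 (Lc ^ (j + 1)) (fun _ => AN (Roots.ctr Lc) j)
        (SpureRecOf 3 (Lc ^ (j + 1))
          (compVhS (fun k => linKerAt (toSite ((Roots.ctr Lc).rc k)) Lc) (fun k => vhKerAt (toSite ((Roots.ctr Lc).rc k)) Lc) Lc (j + 1))
          (compHessFF (fun k => linKerAt (toSite ((Roots.ctr Lc).rc k)) Lc) (fun k => hessKerAt (toSite ((Roots.ctr Lc).rc k)) Lc) Lc (j + 1))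
          (fun _ => AN (Roots.ctr Lc) j) cE cVH cΛ)
        (fun j' μ w => cM j' • compHessFF (fun k => linKerAt (toSite ((Roots.ctr Lc).rc k)) Lc) (fun k => hessKerAt (toSite ((Roots.ctr Lc).rc k)) Lc) Lc (j + 1) μ w)
        cE₂ cB T
        (fun κ u κ' u' => atw (compVh2S (fun k => linKerAt (toSite ((Roots.ctr Lc).rc k)) Lc) (fun k => vhKerAt (toSite ((Roots.ctr Lc).rc k)) Lc)
          (fun k => vh2KerSymAt (toSite ((Roots.ctr Lc).rc k)) Lc) Lc (j + 1) κ u κ' u'))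
        (compMixFFG (fun k => linKerAt (toSite ((Roots.ctr Lc).rc k)) Lc) (fun k => vhKerAt (toSite ((Roots.ctr Lc).rc k)) Lc)
          (fun k => hessKerAt (toSite ((Roots.ctr Lc).rc k)) Lc) (fun k => mixKerAt (toSite ((Roots.ctr Lc).rc k)) Lc) Lc (j + 1)) 0))) := by
  -- abbreviations for the scalars
  have hL : 1 ≤ Lc := one_le_of_neZero Lc
  have hrc : ∀ k, (Roots.ctr Lc).rc k ∈ box (3 + 1) Lc := (Roots.ctr Lc).hrc
  set cH : ℝ := ((((Lc ^ (j + 1) : ℕ) : ℝ)) ^ (3 + 1))⁻¹ with hcH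
  set ξ : ℝ := ((((Lc ^ (j + 1) : ℕ) : ℝ)) ^ (3 + 1))⁻¹ * cE * (1 / 2) with hξ
  -- the rooted bricks' table letters (road g64 XREAD-R §1∕§1b, re-derived over tree objects)
  have hV : ∀ δ : ℝ, 0 ≤ δ → ∃ C : ℝ, LocStencil
      (compVhS (fun k => linKerAt (toSite ((Roots.ctr Lc).rc k)) Lc) (fun k => vhKerAt (toSite ((Roots.ctr Lc).rc k)) Lc) Lc (j + 1)) C δ :=
    fun _ hδ => ⟨_, locStencil_compVhS_rooted hL hrc (j + 1) hδ⟩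
  have hH : ∀ δ : ℝ, 0 ≤ δ → ∃ C : ℝ, VertexFamily
      (compHessFF (fun k => linKerAt (toSite ((Roots.ctr Lc).rc k)) Lc) (fun k => hessKerAt (toSite ((Roots.ctr Lc).rc k)) Lc) Lc (j + 1)) (Lc ^ (j + 1)) C δ :=
    compHessFF_rooted_hH hL hrc (j + 1)
  have hne : (box (3 + 1) Lc).Nonempty := ⟨(Roots.ctr Lc).rc 0, hrc 0⟩
  have hB2 : ∀ k, vh2Abs (toSite ((Roots.ctr Lc).rc k)) Lc ≤ (box (3 + 1) Lc).sup' hne (fun r => vh2Abs (toSite r) Lc) :=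
    fun k => Finset.le_sup' (fun r => vh2Abs (toSite r) Lc) (hrc k)
  have hBM : ∀ k, mixAbs (toSite ((Roots.ctr Lc).rc k)) Lc ≤ (box (3 + 1) Lc).sup' hne (fun r => mixAbs (toSite r) Lc) :=
    fun k => Finset.le_sup' (fun r => mixAbs (toSite r) Lc) (hrc k)
  have hB : ∃ C δ : ℝ, 0 < δ ∧ LocStencil₂ (fun κ u κ' u' => atw (compVh2S (fun k => linKerAt (toSite ((Roots.ctr Lc).rc k)) Lc)
      (fun k => vhKerAt (toSite ((Roots.ctr Lc).rc k)) Lc) (fun k => vh2KerSymAt (toSite ((Roots.ctr Lc).rc k)) Lc) Lc (j + 1) κ u κ' u')) C δ := by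
    have h := locStencil₂_compVh2S_rootedSym hL hrc ((vh2Abs_nonneg _ _).trans (hB2 0)) hB2 (j + 1) zero_le_one
    exact ⟨_, 1, one_pos, fun κ u κ' u' => biLoc_atw (h κ u κ' u') ((h κ u κ' u').nonneg (Sum.inl 0))⟩
  have hmix : ∃ C δ : ℝ, 0 < δ ∧ LocStencilFM (Lc ^ (j + 1)) (compMixFFG (fun k => linKerAt (toSite ((Roots.ctr Lc).rc k)) Lc)
      (fun k => vhKerAt (toSite ((Roots.ctr Lc).rc k)) Lc) (fun k => hessKerAt (toSite ((Roots.ctr Lc).rc k)) Lc) (fun k => mixKerAt (toSite ((Roots.ctr Lc).rc k)) Lc) Lc (j + 1)) C δ :=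
    compMixFFG_hmix (ℓ := fun k => linKerAt (toSite ((Roots.ctr Lc).rc k)) Lc) (𝓋 := fun k => vhKerAt (toSite ((Roots.ctr Lc).rc k)) Lc)
      (𝒽 := fun k => hessKerAt (toSite ((Roots.ctr Lc).rc k)) Lc) (𝓉 := fun k => mixKerAt (toSite ((Roots.ctr Lc).rc k)) Lc)
      (by positivity) (by positivity) (by positivity) ((mixAbs_nonneg _ _).trans (hBM 0))
      (fun k μ y f => AveragingHessianKernelsRooted.abs_linKerAt_le hL μ y (hrc k) f)
      (fun k μ y f f' => AveragingHessianKernelsRooted.abs_vhKerAt_le hL μ y (hrc k) f f')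
      (fun k μ y f f' => AveragingHessianKernelsRooted.abs_hessKerAt_le hL μ y (hrc k) f f')
      (fun k μ y g f f' => (AveragingMixedJetTables.abs_tTab_le (hrc k) μ y f f' g).trans (hBM k)) (j + 1)
  -- the multiplier family's letters (the `tabsOf` pattern) and its member-0 pin
  have hM : ∀ j' : ℕ, ∃ CM δ : ℝ, 0 < δ ∧ VertexFamily (fun μ w => cM j' •
      compHessFF (fun k => linKerAt (toSite ((Roots.ctr Lc).rc k)) Lc) (fun k => hessKerAt (toSite ((Roots.ctr Lc).rc k)) Lc) Lc (j + 1) μ w) (Lc ^ (j + 1)) CM δ := fun j' => by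
    obtain ⟨C, hC⟩ := hH 1 zero_le_one
    exact ⟨_, 1, one_pos, fun μ w => biLoc_smul_ff (hC μ w) (cM j')⟩
  have hMt : ∀ (j' : ℕ) (μ : Fin (3 + 1)) (w t : Fin (3 + 1) → ℤ),
      (fun μ w => cM j' • compHessFF (fun k => linKerAt (toSite ((Roots.ctr Lc).rc k)) Lc) (fun k => hessKerAt (toSite ((Roots.ctr Lc).rc k)) Lc) Lc (j + 1) μ w) μ (w + t) =
        shiftK (-((((Lc ^ (j + 1) : ℕ) : ℤ)) • t))
          ((fun μ w => cM j' • compHessFF (fun k => linKerAt (toSite ((Roots.ctr Lc).rc k)) Lc) (fun k => hessKerAt (toSite ((Roots.ctr Lc).rc k)) Lc) Lc (j + 1) μ w) μ w) := by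
    intro j' μ w t
    funext x z a b
    simp only [Pi.smul_apply, smul_eq_mul, shiftK]
    rw [compHessFF_rooted_translate (j + 1) μ w t]
    rfl
  have hM0 : (fun j' μ w => cM j' • compHessFF (fun k => linKerAt (toSite ((Roots.ctr Lc).rc k)) Lc) (fun k => hessKerAt (toSite ((Roots.ctr Lc).rc k)) Lc) Lc (j + 1) μ w) 0 =
      cΛ • compHessFF (fun k => linKerAt (toSite ((Roots.ctr Lc).rc k)) Lc) (fun k => hessKerAt (toSite ((Roots.ctr Lc).rc k)) Lc) Lc (j + 1) := by
    funext μ w; simp only [hcM0, Pi.smul_apply]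
  -- the scalar locks from the pin rows
  have h₁ : cH * cE * (1 / 2) = ξ := rfl
  have h₂ : cH * cVH = -(ξ * ((Lc : ℝ) ^ (3 + 1)) ^ (j + 1)) := by
    rw [hξ]; linear_combination ((((Lc ^ (j + 1) : ℕ) : ℝ) ^ (3 + 1))⁻¹ / 2) * hcVH
  have hlockB : cH * cB = ξ * cVH := by rw [hξ]; linear_combination (((((Lc ^ (j + 1) : ℕ) : ℝ)) ^ (3 + 1))⁻¹ / 2) * hcB
  have hlockM : cH * (1 : ℝ) = ξ * cM 0 := by
    rw [hξ, hcM0]; linear_combination (-(((((Lc ^ (j + 1) : ℕ) : ℝ)) ^ (3 + 1))⁻¹ / 2)) * hΛE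
  have hcE₂' : cE₂ = cE ^ 2 := hcE₂.symm
  -- a uniform bound on the member-0 multiplier table (for `hD`)
  obtain ⟨CH, hCH⟩ := hH 0 le_rfl
  have hM₀b : ∀ ρ w x z a b, |(fun μ w => cM 0 • compHessFF (fun k => linKerAt (toSite ((Roots.ctr Lc).rc k)) Lc)
      (fun k => hessKerAt (toSite ((Roots.ctr Lc).rc k)) Lc) Lc (j + 1) μ w) ρ w x z a b| ≤ |cM 0| * CH := by
    intro ρ w x z a b
    simp only [Pi.smul_apply, smul_eq_mul, abs_mul]
    exact mul_le_mul_of_nonneg_left (bdd_of_biLoc (hCH ρ w) le_rfl x z a b) (abs_nonneg _)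
  -- the mixed remainder in the letter's text and its identification with PART 111's (`c₂ = 1`, `M2Of … 0` spelled out)
  have eRM : ∀ (y : Fin (3 + 1) → ℤ) (ρ' : Fin (3 + 1)) (w : Fin (3 + 1) → ℤ),
      cH • ∑ v ∈ box (3 + 1) (Lc ^ (j + 1)), divV (fun κ u => M2Of 3 (Lc ^ (j + 1)) (compMixFFG (fun k => linKerAt (toSite ((Roots.ctr Lc).rc k)) Lc)
          (fun k => vhKerAt (toSite ((Roots.ctr Lc).rc k)) Lc) (fun k => hessKerAt (toSite ((Roots.ctr Lc).rc k)) Lc) (fun k => mixKerAt (toSite ((Roots.ctr Lc).rc k)) Lc) Lc (j + 1))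
          0 κ u ρ' w) ((((Lc ^ (j + 1) : ℕ) : ℤ)) • y + toSite v) -
        (comp ((fun μ w => cM 0 • compHessFF (fun k => linKerAt (toSite ((Roots.ctr Lc).rc k)) Lc) (fun k => hessKerAt (toSite ((Roots.ctr Lc).rc k)) Lc) Lc (j + 1) μ w) ρ' w)
            (diagK (ξ • ∑ v ∈ box (3 + 1) (Lc ^ (j + 1)), legInd (toSite ((Roots.ctr Lc).s (j + 1))) ((((Lc ^ (j + 1) : ℕ) : ℤ)) • y + toSite v))) -
          comp (diagK (ξ • ∑ v ∈ box (3 + 1) (Lc ^ (j + 1)), legInd (toSite ((Roots.ctr Lc).s (j + 1))) ((((Lc ^ (j + 1) : ℕ) : ℤ)) • y + toSite v)))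
            ((fun μ w => cM 0 • compHessFF (fun k => linKerAt (toSite ((Roots.ctr Lc).rc k)) Lc) (fun k => hessKerAt (toSite ((Roots.ctr Lc).rc k)) Lc) Lc (j + 1) μ w) ρ' w)) =
      cH • ∑ v ∈ box (3 + 1) (Lc ^ (j + 1)), divV (fun κ u => (1 : ℝ) • compMixFFG (fun k => linKerAt (toSite ((Roots.ctr Lc).rc k)) Lc)
          (fun k => vhKerAt (toSite ((Roots.ctr Lc).rc k)) Lc) (fun k => hessKerAt (toSite ((Roots.ctr Lc).rc k)) Lc) (fun k => mixKerAt (toSite ((Roots.ctr Lc).rc k)) Lc) Lc (j + 1)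
          κ u ρ' w) ((((Lc ^ (j + 1) : ℕ) : ℤ)) • y + toSite v) -
        (comp (cM 0 • compHessFF (fun k => linKerAt (toSite ((Roots.ctr Lc).rc k)) Lc) (fun k => hessKerAt (toSite ((Roots.ctr Lc).rc k)) Lc) Lc (j + 1) ρ' w)
            (diagK (ξ • ∑ v ∈ box (3 + 1) (Lc ^ (j + 1)), legInd (toSite ((Roots.ctr Lc).s (j + 1))) ((((Lc ^ (j + 1) : ℕ) : ℤ)) • y + toSite v))) -
          comp (diagK (ξ • ∑ v ∈ box (3 + 1) (Lc ^ (j + 1)), legInd (toSite ((Roots.ctr Lc).s (j + 1))) ((((Lc ^ (j + 1) : ℕ) : ℤ)) • y + toSite v)))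
            (cM 0 • compHessFF (fun k => linKerAt (toSite ((Roots.ctr Lc).rc k)) Lc) (fun k => hessKerAt (toSite ((Roots.ctr Lc).rc k)) Lc) Lc (j + 1) ρ' w)) := by
    intro y ρ' w
    simp only [M2Of_member_zero, one_smul]
  obtain ⟨CR, δR, hδR, hRM⟩ := vertexFamily_mixedLetterRemainder_rooted (d := 3) (L := Lc) (r := (Roots.ctr Lc).rc) hL hrc (Lc ^ (j + 1)) (j + 1)
    (toSite ((Roots.ctr Lc).s (j + 1))) cH 1 (cM 0) ξ
  have hCR : 0 ≤ CR := (hRM 0 0 0).nonneg (Sum.inl 0)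
  -- the zero remainders of the Wilson and border letters: class and parity
  have hZ : ∀ Y : Fin (3 + 1) → ℤ, LocStencil ((fun (_ : Fin (3 + 1) → ℤ) (_ : Fin (3 + 1)) (_ : Fin (3 + 1) → ℤ) => (0 : MKer (3 + 1) (Fib 3))) Y) CR δR :=
    fun Y κ u => biLoc_weaken (biLoc_zero (F := Fib 3) u u δR) hCR le_rfl
  have hZp : ∀ (Y : Fin (3 + 1) → ℤ) (κ : Fin (3 + 1)) (u : Fin (3 + 1) → ℤ),
      trK ((fun (_ : Fin (3 + 1) → ℤ) (_ : Fin (3 + 1)) (_ : Fin (3 + 1) → ℤ) => (0 : MKer (3 + 1) (Fib 3))) Y κ u) =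
        -sgnK ((fun (_ : Fin (3 + 1) → ℤ) (_ : Fin (3 + 1)) (_ : Fin (3 + 1) → ℤ) => (0 : MKer (3 + 1) (Fib 3))) Y κ u) := fun _ _ _ => parityOdd_zero
  subst hTW
  exact wardTransversal_AN_of_letters (Roots.ctr Lc) j hV hH (fun κ u t => compVhS_rooted_translate hL (j + 1) κ u t)
    (fun μ y t => compHessFF_rooted_translate (j + 1) μ y t) (fun κ u => trK_compVhS_rooted (j + 1) κ u) (fun μ y => trK_compHessFF_rooted (j + 1) μ y)
    hM hMt cE cVH cΛ cE₂ cB hM0 _ hB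
    (fun κ u κ' u' t => by
      show atw _ = shiftK _ (atw _)
      rw [compVh2S_rootedSym_translate hL (j + 1) κ u κ' u' t, atw_shiftK])
    hmix
    (fun κ u μ w t => compMixFFG_translate (ℓ := fun k => linKerAt (toSite ((Roots.ctr Lc).rc k)) Lc) (𝓋 := fun k => vhKerAt (toSite ((Roots.ctr Lc).rc k)) Lc)
      (𝒽 := fun k => hessKerAt (toSite ((Roots.ctr Lc).rc k)) Lc) (𝓉 := fun k => mixKerAt (toSite ((Roots.ctr Lc).rc k)) Lc)
      (fun k μ y t f => AveragingHessianKernelsRooted.linKerAt_add (toSite ((Roots.ctr Lc).rc k)) Lc μ y t f)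
      (fun k μ y t f f' => AveragingHessianKernelsRooted.vhKerAt_add (toSite ((Roots.ctr Lc).rc k)) Lc μ y t f f')
      (fun k μ y t f f' => AveragingHessianKernelsRooted.hessKerAt_add (toSite ((Roots.ctr Lc).rc k)) Lc μ y t f f')
      (fun k μ y t g f f' => AveragingMixedJetTables.mixKerAt_add (toSite ((Roots.ctr Lc).rc k)) Lc μ y t g f f') (j + 1) κ u μ w t)
    ξ
    (fun y => hSd_S0NOf_compVhS_ctr Lc hLc (j + 1) _ hH cΛ h₁ h₂ y)
    (fun y => divV_dM_AN_compVhS_ctr Lc hLc j _ hH (fun _ => AN (Roots.ctr Lc) j) (fun _ => decays_AN (Roots.ctr Lc) j) hM₀b cΛ h₁ h₂ y)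
    (RW := fun _ _ _ => 0) (RW'' := fun _ _ _ => 0) (RB := fun _ _ _ => 0) (RB'' := fun _ _ _ => 0)
    (RM := fun y ρ' w => cH • ∑ v ∈ box (3 + 1) (Lc ^ (j + 1)), divV (fun κ u => M2Of 3 (Lc ^ (j + 1)) (compMixFFG (fun k => linKerAt (toSite ((Roots.ctr Lc).rc k)) Lc)
          (fun k => vhKerAt (toSite ((Roots.ctr Lc).rc k)) Lc) (fun k => hessKerAt (toSite ((Roots.ctr Lc).rc k)) Lc) (fun k => mixKerAt (toSite ((Roots.ctr Lc).rc k)) Lc) Lc (j + 1))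
          0 κ u ρ' w) ((((Lc ^ (j + 1) : ℕ) : ℤ)) • y + toSite v) -
        (comp ((fun μ w => cM 0 • compHessFF (fun k => linKerAt (toSite ((Roots.ctr Lc).rc k)) Lc) (fun k => hessKerAt (toSite ((Roots.ctr Lc).rc k)) Lc) Lc (j + 1) μ w) ρ' w)
            (diagK (ξ • ∑ v ∈ box (3 + 1) (Lc ^ (j + 1)), legInd (toSite ((Roots.ctr Lc).s (j + 1))) ((((Lc ^ (j + 1) : ℕ) : ℤ)) • y + toSite v))) -
          comp (diagK (ξ • ∑ v ∈ box (3 + 1) (Lc ^ (j + 1)), legInd (toSite ((Roots.ctr Lc).s (j + 1))) ((((Lc ^ (j + 1) : ℕ) : ℤ)) • y + toSite v)))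
            ((fun μ w => cM 0 • compHessFF (fun k => linKerAt (toSite ((Roots.ctr Lc).rc k)) Lc) (fun k => hessKerAt (toSite ((Roots.ctr Lc).rc k)) Lc) Lc (j + 1) μ w) ρ' w)))
    ⟨CR, δR, hδR, hZ, hZ, hZ, hZ, fun y ρ' w => by
      have h := hRM y ρ' w
      dsimp only at h ⊢
      rw [← eRM y ρ' w] at h
      exact h⟩
    hZp hZp hZp hZp
    (fun y ρ' w => by
      dsimp only
      rw [eRM y ρ' w]
      exact parityOdd_mixedLetterRemainder_rooted (d := 3) hL hrc (Lc ^ (j + 1)) (j + 1) y (toSite ((Roots.ctr Lc).s (j + 1))) ρ' w hlockM)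
    (fun Y κ' u' => hWil_wsym22_TW_su (L := Lc ^ (j + 1)) hNc (toSite ((Roots.ctr Lc).s (j + 1))) hcE₂' Y κ' u')
    (fun Y κ u => hWil''_wsym22_TW_su (L := Lc ^ (j + 1)) hNc (toSite ((Roots.ctr Lc).s (j + 1))) hcE₂' Y κ u)
    (fun Y κ' u' => (hBord_compB_ctr Lc hLc (j + 1) hlockB Y κ' u').trans (by simp))
    (fun Y κ u => (hBord''_compB_ctr Lc hLc (j + 1) hlockB Y κ u).trans (by simp))
    (fun y ρ' w => by dsimp only; abel)

end Summit.QuantumFields.BalabanUV.Beta.FP.TowerNWardRootedOfPins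

end
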